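import Summits.HodgeConjecture.HodgeConjecture.Theses.EndoscopicMiddleDegree
import Summits.HodgeConjecture.HodgeConjecture.Theorems.BallQuotientHodgeAbsolute.Negative.HodgeImpliesAbsoluteHodge
import Literature.AlgebraicGeometry.HodgeTheory.HodgeModelExistence
import Summits.HodgeConjecture.HodgeConjecture.Theorems.BallQuotientHodgeAbsolute
import Summits.HodgeConjecture.HodgeConjecture.Theorems.NikulinTwinTransportSquareTypeTwoTwo

/-!
# `BallQuotientHodgeAbsolute` certifies single-valued chart conjugation (negative-side lemmas, cycle 2)

Support file for the crux `BallQuotientHodgeAbsolute` (stmt-HodgeConjecture-14348; DROPPED from route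
`EndoscopicMiddleDegree` at rev 4, 2026-08-16, and since then the landed obligation node
`Summit.HodgeConjecture.HodgeConjecture.Theorems.BallQuotientHodgeAbsolute` of `Theorems/BallQuotientHodgeAbsolute.lean`,
same text — to which the bare identifier below resolves since the full-build repair of 2026-08-17), refuter lane
`Theorems/BallQuotientHodgeAbsolute/Negative/` (helpers; no Theses decl is asserted).

The conclusion `IsAbsoluteHodgeClass` of the crux quantifies over ALL conjugation charts
`D : ConjugationChart σ X (2p)` and ALL `c'` with `D.Conjugates c c'`. This file proves, sorry-free:

1. **Conjugation calculus in a fixed chart.** `D.Conjugates` is closed under addition (`conjugates_add`) and is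
   `σ`-SEMILINEAR (`conjugates_smul`: multiply all coefficients by the constant global function `κ`, whose
   pull-back to `Y^σ` is the constant `σ κ`, `appTop_fst_const`). Hence the conjugates of `0` in a chart are
   closed under `+` and under ALL complex scalars (`conjugates_zero_add`, `conjugates_zero_smul`).
2. **Core lemma** (`conjugates_unique_of_forall_rational`): if every `D`-conjugate of a class `c` is
   `periodTwist σ p •` (a rational class) — the shape of the crux's conclusion — then `c` has at most
   one conjugate in `D` (two conjugates give conjugates `c' + ν (c'' - c')` for every `ν ∈ ℂ`;
   `ν = 1, i` produce a rational class with rational `i`-multiple, which is `0`).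
3. **Lower bound on any proof of the crux**: the crux implies that on every even-dimensional
   compact ball quotient, in the middle degree, in every chart, a rational `(p,p)`-class has a unique
   conjugate (`conjugates_unique_of_ballQuotientHodgeAbsolute`); granted a Hodge model (`nonempty_hodgeModel`),
   every conjugate of `0` is `0` and chart conjugation is single-valued on ALL classes
   (`conjugates_zero_eq_zero_of_…`, `conjugates_functional_of_…`) — the fragment of Grothendieck's
   algebraic/analytic de Rham comparison on the affine chart on which the definition's informal junk analysis
   rests: the crux CERTIFIES it, so any proof of the crux proves it for every chart over the family. Contrapositives (`not_ballQuotientHodgeAbsolute_of_multivalued_chart`, `…_of_two_conjugates`):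
   ONE chart over ONE such variety with two distinct conjugates of one class refutes the crux.
4. **The zero class, exactly** (`isAbsoluteHodgeClass_zero_iff_functional`): given Hodge models of `X` and its
   conjugates, `0` is absolute Hodge iff charts exist for all `σ` and every chart is single-valued at `0`.
5. **`ℚˣ`-rescaling of absolute Hodge classes is formal** (`isAbsoluteHodgeClass_smul_rat`), whereas
   additivity and the zero class are not (they need item 3's fragment).

References: Charles–Schnell 2014 §11.2.2; Grothendieck 1966 Thm. 1'; Jouanolou 1973 Lemme 1.5.
-/

noncomputable section

open CategoryTheory CategoryTheory.Limits AlgebraicGeometry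
open scoped Manifold ContDiff

namespace Summit.HodgeConjecture.HodgeConjecture.Theorems.BallQuotientHodgeAbsolute.Negative

open Summit.HodgeConjecture.HodgeConjecture.Theses.EndoscopicMiddleDegree
open Literature.AlgebraicGeometry Literature.AlgebraicGeometry.HodgeTheory
  Literature.AlgebraicGeometry.Motives Literature.AlgebraicGeometry.ShimuraVarieties
  Literature.AlgebraicTopology.SingularHomology Literature.NumberTheory.Transcendental

/-! ## 1. Conjugation calculus on presentations -/

section Calculus

variable {Y : SchemeOver ℂ} {k : ℕ} {E : Type} [NormedAddCommGroup E] [NormedSpace ℂ E]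
  [FiniteDimensional ℂ E] {m : ℕ}

/-- The concatenation of two expressions realises the sum of the realisations. [folklore] -/
theorem realize_append (ξ η : AlgFormExpr Y k) (A : AnalyticModel E m Y) :
    (⟨ξ.size + η.size, Fin.append ξ.coef η.coef, Fin.append ξ.arg η.arg⟩ : AlgFormExpr Y k).realize A
      = ξ.realize A + η.realize A := by
  unfold AlgFormExpr.realize
  simp only
  rw [Fin.sum_univ_add]
  simp only [Fin.append_left, Fin.append_right]

/-- Conjugation commutes with concatenation, on realisations. [folklore] -/
theorem realize_conj_append (σ : ℂ ≃+* ℂ) (ξ η : AlgFormExpr Y k)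
    (A : AnalyticModel E m (conjugateVariety σ Y)) :
    ((⟨ξ.size + η.size, Fin.append ξ.coef η.coef, Fin.append ξ.arg η.arg⟩ : AlgFormExpr Y k).conj
        σ).realize A = (ξ.conj σ).realize A + (η.conj σ).realize A := by
  unfold AlgFormExpr.realize AlgFormExpr.conj
  simp only
  rw [Fin.sum_univ_add]
  simp only [Fin.append_left, Fin.append_right]

/-- The constant global function `κ · 1 = Y.hom^* κ` takes the value `κ` at every complex point
(`P ≫ Y.hom = 𝟙`). [folklore] -/
theorem eval_top_const (P : ComplexPoints Y) (κ : ℂ) :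
    P.eval ⊤ trivial (Y.hom.appTop ((Scheme.ΓSpecIso (.of ℂ)).inv κ)) = κ := by
  rw [AlgPoints.eval_top]
  change (Scheme.ΓSpecIso (.of ℂ)).hom (P.toSpecHom.appTop (Y.hom.appTop _)) = κ
  rw [← CategoryTheory.comp_apply (Y.hom.appTop) (P.toSpecHom.appTop),
    ← Scheme.Hom.comp_appTop, ComplexPoints.toSpecHom_comp_hom]
  simp

/-- Regular functions multiply pointwise: a global function `cst` with constant value `κ` on `Y(ℂ)`
multiplies values by `κ`. [folklore] -/
theorem regularFun_mul_of_eval (A : AnalyticModel E m Y) {cst : Γ(Y.left, ⊤)} {κ : ℂ}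
    (hcst : ∀ P : ComplexPoints Y, P.eval ⊤ trivial cst = κ) (s : Γ(Y.left, ⊤)) :
    A.regularFun (cst * s) = fun x ↦ κ * A.regularFun s x := by
  funext x
  simp only [AnalyticModel.regularFun,
    AlgPoints.evalOrZero_of_mem _ (TopologicalSpace.Opens.mem_top _)]
  rw [← AlgPoints.evalRingHom_apply, map_mul, AlgPoints.evalRingHom_apply,
    AlgPoints.evalRingHom_apply, hcst]

/-- **Conjugation of constants is `σ`**: pulling the constant `κ` back along `Y^σ → Y` gives the
constant `σ κ` for the `ℂ`-structure of `Y^σ` — the tree's `conjugateVariety σ Y` is the base change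
along `σ` itself (pullback square `fst ≫ Y.hom = snd ≫ Spec σ` and naturality of `ΓSpecIso`).
[cite: CharlesSchnell2014Notes, §11.2.2 (11.2.2)] -/
theorem appTop_fst_const (σ : ℂ ≃+* ℂ) (Y : SchemeOver ℂ) (κ : ℂ) :
    (baseChangeHomFst σ.toRingHom Y).appTop (Y.hom.appTop ((Scheme.ΓSpecIso (.of ℂ)).inv κ)) =
      (conjugateVariety σ Y).hom.appTop ((Scheme.ΓSpecIso (.of ℂ)).inv (σ κ)) := by
  have e2 := DFunLike.congr_fun (congrArg CommRingCat.Hom.hom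
    (Scheme.ΓSpecIso_inv_naturality (CommRingCat.ofHom σ.toRingHom))) κ
  simp only [CommRingCat.hom_comp, RingHom.comp_apply, CommRingCat.hom_ofHom] at e2
  have hB := congrArg
    (fun φ ↦ (Scheme.Hom.appTop φ).hom ((Scheme.ΓSpecIso (.of ℂ)).inv.hom κ))
    (pullback.condition (f := Y.hom) (g := Spec.map (CommRingCat.ofHom σ.toRingHom)))
  exact hB.trans (congrArg
    (fun t ↦ (Scheme.Hom.appTop
      (pullback.snd Y.hom (Spec.map (CommRingCat.ofHom σ.toRingHom)))).hom t) e2.symm)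

/-- The conjugate `(Y^σ → Y)^* κ` of the constant `κ` has constant value `σ κ` on `Y^σ(ℂ)`. [folklore] -/
theorem eval_top_appTop_fst_const (σ : ℂ ≃+* ℂ) (Q : ComplexPoints (conjugateVariety σ Y)) (κ : ℂ) :
    Q.eval ⊤ trivial ((baseChangeHomFst σ.toRingHom Y).appTop
      (Y.hom.appTop ((Scheme.ΓSpecIso (.of ℂ)).inv κ))) = σ κ :=
  (congrArg (Q.eval ⊤ trivial) (appTop_fst_const σ Y κ)).trans (eval_top_const Q (σ κ))

/-- On the conjugate model: if `(Y^σ → Y)^* cst` has constant value `κ'`, the conjugate of `cst · s`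
is `κ'` times the conjugate of `s`, pointwise. [folklore] -/
theorem regularFun_appTop_mul_of_eval (σ : ℂ ≃+* ℂ) (A : AnalyticModel E m (conjugateVariety σ Y))
    {cst : Γ(Y.left, ⊤)} {κ' : ℂ}
    (hcst' : ∀ Q : ComplexPoints (conjugateVariety σ Y),
      Q.eval ⊤ trivial ((baseChangeHomFst σ.toRingHom Y).appTop cst) = κ')
    (s : Γ(Y.left, ⊤)) :
    A.regularFun ((baseChangeHomFst σ.toRingHom Y).appTop (cst * s)) =
      fun x ↦ κ' * A.regularFun ((baseChangeHomFst σ.toRingHom Y).appTop s) x := by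
  rw [map_mul]
  exact regularFun_mul_of_eval A hcst' _

/-- Scaling all coefficients by a global function with constant value `κ` scales the realisation
by `κ`. [folklore] -/
theorem realize_scale_of_eval {cst : Γ(Y.left, ⊤)} {κ : ℂ}
    (hcst : ∀ P : ComplexPoints Y, P.eval ⊤ trivial cst = κ) (ξ : AlgFormExpr Y k)
    (A : AnalyticModel E m Y) :
    (⟨ξ.size, fun j ↦ cst * ξ.coef j, ξ.arg⟩ : AlgFormExpr Y k).realize A = κ • ξ.realize A := by
  unfold AlgFormExpr.realize
  simp only [regularFun_mul_of_eval A hcst]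
  rw [Finset.smul_sum]
  refine Finset.sum_congr rfl fun j _ ↦ ?_
  funext x
  simp only [Pi.smul_apply, mul_smul]

/-- … and, if the conjugate of that function has constant value `κ'`, scales the realisation of the
conjugate expression by `κ'` (with `κ' = σ κ`: σ-SEMILINEARITY of conjugation on presentations).
[cite: CharlesSchnell2014Notes, §11.2.2 (11.2.2)] -/
theorem realize_conj_scale_of_eval (σ : ℂ ≃+* ℂ) {cst : Γ(Y.left, ⊤)} {κ' : ℂ}
    (hcst' : ∀ Q : ComplexPoints (conjugateVariety σ Y),
      Q.eval ⊤ trivial ((baseChangeHomFst σ.toRingHom Y).appTop cst) = κ')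
    (ξ : AlgFormExpr Y k) (A : AnalyticModel E m (conjugateVariety σ Y)) :
    ((⟨ξ.size, fun j ↦ cst * ξ.coef j, ξ.arg⟩ : AlgFormExpr Y k).conj σ).realize A =
      κ' • (ξ.conj σ).realize A := by
  unfold AlgFormExpr.realize AlgFormExpr.conj
  simp only [regularFun_appTop_mul_of_eval σ A hcst']
  rw [Finset.smul_sum]
  refine Finset.sum_congr rfl fun j _ ↦ ?_
  funext x
  simp only [Pi.smul_apply, mul_smul]

end Calculus

/-! ## 2. Conjugate pairs in a fixed chart: additive and `σ`-semilinear -/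

section Chart

variable {σ : ℂ ≃+* ℂ} {X : SchemeOver ℂ} {k : ℕ} (D : ConjugationChart σ X k)

/-- **Additivity of chart conjugation**: in a fixed chart, conjugate pairs add. [folklore] -/
theorem conjugates_add {c₁ c₂ : complexBetti X k}
    {c₁' c₂' : complexBetti (conjugateVariety σ X) k}
    (h₁ : D.Conjugates c₁ c₁') (h₂ : D.Conjugates c₂ c₂') :
    D.Conjugates (c₁ + c₂) (c₁' + c₂') := by
  obtain ⟨ξ₁, hξ₁, hξ₁', e₁, e₁'⟩ := h₁
  obtain ⟨ξ₂, hξ₂, hξ₂', e₂, e₂'⟩ := h₂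
  have hr := realize_append ξ₁ ξ₂ D.an
  have hr' := realize_conj_append σ ξ₁ ξ₂ D.anConj
  refine ⟨⟨ξ₁.size + ξ₂.size, Fin.append ξ₁.coef ξ₂.coef, Fin.append ξ₁.arg ξ₂.arg⟩,
    hr ▸ add_mem hξ₁ hξ₂, hr' ▸ add_mem hξ₁' hξ₂', ?_, ?_⟩
  · have : (⟨_, hr ▸ add_mem hξ₁ hξ₂⟩ : cclosedSmoothForms D.E D.an.carrier k) =
        ⟨_, hξ₁⟩ + ⟨_, hξ₂⟩ := Subtype.ext hr
    rw [this, map_add, map_add, map_add, map_add, e₁, e₂]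
  · have : (⟨_, hr' ▸ add_mem hξ₁' hξ₂'⟩ : cclosedSmoothForms D.E D.anConj.carrier k) =
        ⟨_, hξ₁'⟩ + ⟨_, hξ₂'⟩ := Subtype.ext hr'
    rw [this, map_add, map_add, map_add, map_add, e₁', e₂']

/-- **`σ`-semilinearity of chart conjugation**: if `c'` is conjugate to `c` in `D` then `σ(κ) • c'`
is conjugate to `κ • c` in `D`. [cite: CharlesSchnell2014Notes, §11.2.2 (11.2.2)] -/
theorem conjugates_smul (κ : ℂ) {c : complexBetti X k} {c' : complexBetti (conjugateVariety σ X) k}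
    (h : D.Conjugates c c') : D.Conjugates (κ • c) (σ κ • c') := by
  obtain ⟨ξ, hξ, hξ', e, e'⟩ := h
  have hr := realize_scale_of_eval (fun P ↦ eval_top_const P κ) ξ D.an
  have hr' := realize_conj_scale_of_eval σ (fun Q ↦ eval_top_appTop_fst_const σ Q κ) ξ D.anConj
  refine ⟨⟨ξ.size, fun j ↦ D.Y.hom.appTop ((Scheme.ΓSpecIso (.of ℂ)).inv κ) * ξ.coef j, ξ.arg⟩,
    hr ▸ Submodule.smul_mem _ κ hξ, hr' ▸ Submodule.smul_mem _ (σ κ) hξ', ?_, ?_⟩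
  · have : (⟨_, hr ▸ Submodule.smul_mem _ κ hξ⟩ : cclosedSmoothForms D.E D.an.carrier k) =
        κ • ⟨_, hξ⟩ := Subtype.ext hr
    rw [this, map_smul, map_smul, map_smul, map_smul, e]
  · have : (⟨_, hr' ▸ Submodule.smul_mem _ (σ κ) hξ'⟩ :
        cclosedSmoothForms D.E D.anConj.carrier k) = σ κ • ⟨_, hξ'⟩ := Subtype.ext hr'
    rw [this, map_smul, map_smul, map_smul, map_smul, e']

/-- Negation of conjugate pairs (`κ = -1`). [folklore] -/
theorem conjugates_neg {c : complexBetti X k} {c' : complexBetti (conjugateVariety σ X) k}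
    (h : D.Conjugates c c') : D.Conjugates (-c) (-c') := by
  have := conjugates_smul D (-1) h
  rwa [map_neg, map_one, neg_one_smul, neg_one_smul] at this

/-- Two conjugates of one class differ by a conjugate of `0`. [folklore] -/
theorem conjugates_zero_sub {c : complexBetti X k} {c' c'' : complexBetti (conjugateVariety σ X) k}
    (h' : D.Conjugates c c') (h'' : D.Conjugates c c'') : D.Conjugates 0 (c'' - c') := by
  have := conjugates_add D h'' (conjugates_neg D h')
  rwa [add_neg_cancel, ← sub_eq_add_neg] at this

/-- The conjugates of `0` in a chart are closed under addition … [folklore] -/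
theorem conjugates_zero_add {a b : complexBetti (conjugateVariety σ X) k}
    (ha : D.Conjugates 0 a) (hb : D.Conjugates 0 b) : D.Conjugates 0 (a + b) := by
  simpa only [add_zero] using conjugates_add D ha hb

/-- … and under ALL complex scalars (`σ` is onto): they form a `ℂ`-subspace. [folklore] -/
theorem conjugates_zero_smul (μ : ℂ) {a : complexBetti (conjugateVariety σ X) k}
    (ha : D.Conjugates 0 a) : D.Conjugates 0 (μ • a) := by
  simpa only [smul_zero, RingEquiv.apply_symm_apply] using conjugates_smul D (σ.symm μ) ha

end Chart

/-! ## 3. The uniqueness lower bound -/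

section Unique

/-- Rational classes are closed under subtraction — deprecated local copy (gate dedup 2026-08-17) of the landed
`NikulinTwinTransport.isRationalClass_sub`. [cite: HatcherAT2002, §3.1] -/
@[deprecated NikulinTwinTransport.isRationalClass_sub (since := "2026-08-17")]
alias isRationalClass_sub := NikulinTwinTransport.isRationalClass_sub

/-- **Core lemma.** If every `D`-conjugate of `c` is `periodTwist σ p` times a RATIONAL class (the
shape of the crux's conclusion; Hodge type is not even needed), then `c` has at most one conjugate
in `D`: two conjugates `c', c''` yield the conjugates `c' + ν • (c'' - c')` for all `ν ∈ ℂ`, and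
`ν = 1, i` give a rational class with rational `i`-multiple, i.e. `0`. [folklore] -/
theorem conjugates_unique_of_forall_rational {σ : ℂ ≃+* ℂ} {X : SchemeOver ℂ} {p : ℕ}
    (D : ConjugationChart σ X (2 * p)) {c : complexBetti X (2 * p)}
    (h : ∀ c', D.Conjugates c c' →
      ∃ β : complexBetti (conjugateVariety σ X) (2 * p), IsRationalClass β ∧ c' = periodTwist σ p • β)
    {c' c'' : complexBetti (conjugateVariety σ X) (2 * p)}
    (h' : D.Conjugates c c') (h'' : D.Conjugates c c'') : c' = c'' := by
  have hd0 : D.Conjugates 0 (c'' - c') := conjugates_zero_sub D h' h''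
  have hν : ∀ ν : ℂ, D.Conjugates c (c' + ν • (c'' - c')) := fun ν ↦ by
    have := conjugates_add D h' (conjugates_zero_smul D ν hd0)
    rwa [add_zero] at this
  obtain ⟨β₀, hβ₀, e₀⟩ := h c' h'
  obtain ⟨β₁, hβ₁, e₁⟩ := h _ (hν 1)
  obtain ⟨β₂, hβ₂, e₂⟩ := h _ (hν Complex.I)
  have ht : periodTwist σ p ≠ 0 := periodTwist_ne_zero σ p
  have hd1 : c'' - c' = periodTwist σ p • (β₁ - β₀) := by
    rw [smul_sub (periodTwist σ p) β₁ β₀, ← e₁, ← e₀, one_smul, add_sub_cancel_left]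
  have hdI : Complex.I • (c'' - c') = periodTwist σ p • (β₂ - β₀) := by
    rw [smul_sub (periodTwist σ p) β₂ β₀, ← e₂, ← e₀, add_sub_cancel_left]
  have hγ : Complex.I • (β₁ - β₀) = β₂ - β₀ := by
    apply smul_right_injective _ ht
    dsimp only
    rw [smul_comm, ← hd1]
    exact hdI
  have hzero : β₁ - β₀ = 0 :=
    eq_zero_of_isRationalClass_of_I_smul (NikulinTwinTransport.isRationalClass_sub hβ₁ hβ₀)
      (hγ ▸ NikulinTwinTransport.isRationalClass_sub hβ₂ hβ₀)
  have : c'' - c' = 0 := by rw [hd1, hzero, smul_zero]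
  exact (sub_eq_zero.1 this).symm

/-- **Uniqueness lower bound, class by class.** The crux implies: on an even-dimensional compact
ball quotient, a rational middle `(p,p)`-class has AT MOST ONE `σ`-conjugate in any conjugation
chart. [folklore] -/
theorem conjugates_unique_of_ballQuotientHodgeAbsolute (h : BallQuotientHodgeAbsolute) {m : ℕ}
    {X : SchemeOver ℂ} (hD : Nonempty (UnitaryBallQuotientDatum (2 * (m + 1)) X)) {σ : ℂ ≃+* ℂ}
    (D : ConjugationChart σ X (2 * (m + 1))) {c : complexBetti X (2 * (m + 1))}
    (hc : IsRationalClass c) (hH : IsOfHodgeType (2 * (m + 1)) X (2 * (m + 1)) (m + 1) (m + 1) c)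
    {c' c'' : complexBetti (conjugateVariety σ X) (2 * (m + 1))}
    (h' : D.Conjugates c c') (h'' : D.Conjugates c c'') : c' = c'' :=
  conjugates_unique_of_forall_rational D
    (fun e he ↦ by
      obtain ⟨β, hβ, -, rfl⟩ := ((h m X hD c hc hH).2.2 σ).2 e ⟨D, he⟩
      exact ⟨β, hβ, rfl⟩)
    h' h''

/-- **Every conjugate of `0` is `0` (the Grothendieck fragment), from the crux**, granted a Hodge
model of `X` (tree fact, needed only for "`0` is of type `(p,p)`"): in every conjugation chart over
an even-dimensional compact ball quotient, in the middle degree, an algebraic form expression whose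
realisation has zero de Rham class has a conjugate whose class pulls back from `0` only.
[cite: Grothendieck1966, Thm. 1'] -/
theorem conjugates_zero_eq_zero_of_ballQuotientHodgeAbsolute (h : BallQuotientHodgeAbsolute)
    {m : ℕ} {X : SchemeOver ℂ} (hD : Nonempty (UnitaryBallQuotientDatum (2 * (m + 1)) X))
    (hM : nonempty_hodgeModel (2 * (m + 1)) X) {σ : ℂ ≃+* ℂ}
    (D : ConjugationChart σ X (2 * (m + 1)))
    {c' : complexBetti (conjugateVariety σ X) (2 * (m + 1))} (hc' : D.Conjugates 0 c') : c' = 0 :=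
  (conjugates_unique_of_ballQuotientHodgeAbsolute h hD D IsRationalClass.zero
    (isOfHodgeType_zero_of_isSmoothProjective hM hD.some.isSmoothProjective _ _ _)
    D.conjugates_zero hc').symm

/-- **The crux makes chart conjugation single-valued on ALL middle-degree classes** (rational or
not, Hodge or not): two conjugates of any class differ by a conjugate of `0`. [folklore] -/
theorem conjugates_functional_of_ballQuotientHodgeAbsolute (h : BallQuotientHodgeAbsolute)
    {m : ℕ} {X : SchemeOver ℂ} (hD : Nonempty (UnitaryBallQuotientDatum (2 * (m + 1)) X))
    (hM : nonempty_hodgeModel (2 * (m + 1)) X) {σ : ℂ ≃+* ℂ}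
    (D : ConjugationChart σ X (2 * (m + 1))) {c : complexBetti X (2 * (m + 1))}
    {c' c'' : complexBetti (conjugateVariety σ X) (2 * (m + 1))}
    (h' : D.Conjugates c c') (h'' : D.Conjugates c c'') : c' = c'' := by
  have := conjugates_zero_eq_zero_of_ballQuotientHodgeAbsolute h hD hM D
    (conjugates_zero_sub D h' h'')
  exact (sub_eq_zero.1 this).symm

/-- **Kill shape 1 (contrapositive).** ONE conjugation chart over ONE even-dimensional compact ball
quotient (with a Hodge model) in which `0` has a non-zero conjugate in the middle degree refutes the
crux. This is the whole junk-attack surface of the rendering; it is closed exactly by the informal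
pinning of `ConjugationChart`. [cite: Grothendieck1966, Thm. 1'] -/
theorem not_ballQuotientHodgeAbsolute_of_multivalued_chart {m : ℕ} {X : SchemeOver ℂ}
    (hD : Nonempty (UnitaryBallQuotientDatum (2 * (m + 1)) X))
    (hM : nonempty_hodgeModel (2 * (m + 1)) X) {σ : ℂ ≃+* ℂ}
    (D : ConjugationChart σ X (2 * (m + 1))) {c' : complexBetti (conjugateVariety σ X) (2 * (m + 1))}
    (hc' : D.Conjugates 0 c') (hne : c' ≠ 0) : ¬ BallQuotientHodgeAbsolute := fun h ↦
  hne (conjugates_zero_eq_zero_of_ballQuotientHodgeAbsolute h hD hM D hc')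

/-- **Kill shape 2** (no Hodge-model fact): two DISTINCT conjugates, in one chart, of one rational
middle `(p,p)`-class on one even-dimensional compact ball quotient refute the crux. [folklore] -/
theorem not_ballQuotientHodgeAbsolute_of_two_conjugates {m : ℕ} {X : SchemeOver ℂ}
    (hD : Nonempty (UnitaryBallQuotientDatum (2 * (m + 1)) X)) {σ : ℂ ≃+* ℂ}
    (D : ConjugationChart σ X (2 * (m + 1))) {c : complexBetti X (2 * (m + 1))}
    (hc : IsRationalClass c) (hH : IsOfHodgeType (2 * (m + 1)) X (2 * (m + 1)) (m + 1) (m + 1) c)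
    {c' c'' : complexBetti (conjugateVariety σ X) (2 * (m + 1))}
    (h' : D.Conjugates c c') (h'' : D.Conjugates c c'') (hne : c' ≠ c'') :
    ¬ BallQuotientHodgeAbsolute := fun h ↦
  hne (conjugates_unique_of_ballQuotientHodgeAbsolute h hD D hc hH h' h'')

/-! ## 4. The zero class, exactly -/

/-- If `0` is absolute Hodge then every chart is single-valued at `0`. [folklore] -/
theorem conjugates_zero_eq_zero_of_isAbsoluteHodgeClass_zero {n : ℕ} {X : SchemeOver ℂ} {p : ℕ}
    (h : IsAbsoluteHodgeClass n X p 0) {σ : ℂ ≃+* ℂ} (D : ConjugationChart σ X (2 * p))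
    {c' : complexBetti (conjugateVariety σ X) (2 * p)} (hc' : D.Conjugates 0 c') : c' = 0 := by
  refine (conjugates_unique_of_forall_rational D (fun e he ↦ ?_) D.conjugates_zero hc').symm
  obtain ⟨β, hβ, -, rfl⟩ := (h.2.2 σ).2 e ⟨D, he⟩
  exact ⟨β, hβ, rfl⟩

/-- **The zero class, exactly** (upgrades the cycle-1 near-miss `isAbsoluteHodgeClass_zero`):
granted that `0` is of type `(p,p)` on `X` and on its conjugates (Hodge models), `0 ∈ H²ᵖ(X(ℂ); ℂ)`
is absolute Hodge IF AND ONLY IF for every `σ` a conjugation chart exists AND every chart is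
single-valued at `0`. The second conjunct is the Grothendieck-comparison fragment; it is not provable
in the tree today. [cite: Grothendieck1966, Thm. 1'] -/
theorem isAbsoluteHodgeClass_zero_iff_functional {n : ℕ} {X : SchemeOver ℂ} {p : ℕ}
    (h0 : IsOfHodgeType n X (2 * p) p p 0)
    (h0σ : ∀ σ : ℂ ≃+* ℂ, IsOfHodgeType n (conjugateVariety σ X) (2 * p) p p 0) :
    IsAbsoluteHodgeClass n X p 0 ↔
      (∀ σ : ℂ ≃+* ℂ, Nonempty (ConjugationChart σ X (2 * p))) ∧
        ∀ (σ : ℂ ≃+* ℂ) (D : ConjugationChart σ X (2 * p))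
          (c' : complexBetti (conjugateVariety σ X) (2 * p)), D.Conjugates 0 c' → c' = 0 := by
  constructor
  · intro h
    exact ⟨fun σ ↦ nonempty_conjugationChart_of_isAbsoluteHodgeClass h σ,
      fun σ D c' hc' ↦ conjugates_zero_eq_zero_of_isAbsoluteHodgeClass_zero h D hc'⟩
  · rintro ⟨hch, hfun⟩
    refine ⟨IsRationalClass.zero, h0, fun σ ↦ ⟨?_, fun c' hc' ↦ ?_⟩⟩
    · obtain ⟨D⟩ := hch σ
      exact ⟨0, isConjugateClass_zero D⟩
    · obtain ⟨D, hD⟩ := hc'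
      obtain rfl := hfun σ D c' hD
      exact ⟨0, IsRationalClass.zero, h0σ σ, (smul_zero _).symm⟩

/-! ## 5. `ℚˣ`-rescaling of absolute Hodge classes is formal -/

/-- **`ℚˣ`-rescaling of absolute Hodge classes** (semilinear scaling of chart conjugates by `q` and
`q⁻¹`, `σ q = q`). Additivity and the zero class are NOT formal: they need the fragment of §3.
[cite: CharlesSchnell2014Notes, §11.2.2] -/
theorem isAbsoluteHodgeClass_smul_rat {n : ℕ} {X : SchemeOver ℂ} {p : ℕ}
    {c : complexBetti X (2 * p)} (h : IsAbsoluteHodgeClass n X p c) {q : ℚ} (hq : q ≠ 0) :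
    IsAbsoluteHodgeClass n X p ((q : ℂ) • c) := by
  refine ⟨h.1.smul q, isOfHodgeType_smul h.2.1 _, fun σ ↦ ⟨?_, fun c'' hc'' ↦ ?_⟩⟩
  · obtain ⟨c', D, hD⟩ := (h.2.2 σ).1
    exact ⟨σ q • c', D, conjugates_smul D (q : ℂ) hD⟩
  · obtain ⟨D, hD⟩ := hc''
    have h1 : D.Conjugates c (σ (q : ℂ)⁻¹ • c'') := by
      have := conjugates_smul D ((q : ℂ)⁻¹) hD
      rwa [smul_smul, inv_mul_cancel₀ (Rat.cast_ne_zero.2 hq), one_smul] at this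
    obtain ⟨β, hβ, hβH, e⟩ := (h.2.2 σ).2 _ ⟨D, h1⟩
    refine ⟨(q : ℂ) • β, hβ.smul q, isOfHodgeType_smul hβH _, ?_⟩
    rw [map_inv₀, map_ratCast] at e
    rw [smul_comm, ← e, smul_smul, mul_inv_cancel₀ (Rat.cast_ne_zero.2 hq), one_smul]

end Unique

end Summit.HodgeConjecture.HodgeConjecture.Theorems.BallQuotientHodgeAbsolute.Negative
end
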